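import Summits.PneNP.PneNP.Theorems.NegLimitedAmplifiedWindowDefs
import Summits.PneNP.PneNP.Theorems.NegLimitedAmplifiedWindowSlicesVerifier
import Summits.PneNP.PneNP.Theorems.NegLimitedCliqueSlices
import Literature.Computability.Complexity.CliqueTestGraphs
import Mathlib
import HarnessLib

/-!
# Amplified critical window — stub S, part 2: the verifier's rounds evaluate `RM3_d`; block cliques
(cell pnp-ideate, rung F-N1/p3, ROUND-11; line `amplified-window` on item stmt-PneNP-19860, stub S
`AmplifiedCliqueSlicesNP`; card HOME/pnp-ideate-p3/r11/amplified-window.md §4)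

Between the verifier (`NegLimitedAmplifiedWindowSlicesVerifier.lean`) and the slice theorem
(`NegLimitedAmplifiedWindowSlicesNP.lean`):
* `recMaj3_succ_snoc` (peel the LAST letter of the leaf address), `recMaj3_const`;
* `rounds_eval`: the `d` stride-`L/3` majority rounds of the verifier evaluate `recMaj3 d` on the block
  bits numbered little-endian by `finFunctionFinEquiv` (`ffe_snoc_val`);
* `ampLen_inj`, `params_of_checks`: the length `ampLen n k` (`k < n`) determines `(n, k, ⌊log₃ n⌋)`;
* `blockVec`, `ampSlice n k x = RM3_d (w ↦ CLIQUE(n,k)(block w of x))`, its monotonicity and values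
  at the constant inputs, and `clique_of_blockBit` (an accepted block has a `k`-clique:
  `NegLimSlices.cliqueFn_edgeVec_iff`).

References: S. Arora, B. Barak, *Computational Complexity* (2009), §2.1 Ex. 2.2 [AroraBarakCC2009];
R. O'Donnell, *Hardness amplification within NP*, JCSS 69 (2004), §1 [ODonnell2004].

HONEST FRAMING: slice plumbing for stub S of an OPEN line; nothing here bears on P vs NP.
-/

set_option linter.dupNamespace false -- `Summit.PneNP.PneNP.…`: summit = sub-problem name (D-0017 single-conjunct layout)

namespace Summit.PneNP.PneNP.Theorems.NegLimitedAmplifiedWindow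

open Finset
open Literature.Computability.Complexity Literature.Barriers.PneNP
open Summit.PneNP.PneNP.Theorems.NegLimSlices
open SlicesNP
/-! ### Recursive majority: peeling the last letter, constants -/

/-- `RM3_{d+1}(x) = RM3_d(w ↦ MAJ3(x(w·0), x(w·1), x(w·2)))` (peel the LAST letter). -/
theorem recMaj3_succ_snoc (d : ℕ) (x : (Fin (d + 1) → Fin 3) → Bool) :
    recMaj3 (d + 1) x =
      recMaj3 d (fun w => maj3 (x (Fin.snoc w 0)) (x (Fin.snoc w 1)) (x (Fin.snoc w 2))) := by
  induction d with
  | zero =>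
    simp only [recMaj3]
    have h : ∀ i : Fin 3, (Matrix.vecCons i (default : Fin 0 → Fin 3) : Fin 1 → Fin 3) =
        Fin.snoc (default : Fin 0 → Fin 3) i := fun i => by
      funext j
      rw [Fin.fin_one_eq_zero j]
      rfl
    rw [h 0, h 1, h 2]
  | succ d ih =>
    rw [recMaj3, ih, ih, ih, recMaj3]
    have h : ∀ (i : Fin 3) (w : Fin d → Fin 3) (j : Fin 3),
        (Matrix.vecCons i (Fin.snoc w j) : Fin (d + 2) → Fin 3) = Fin.snoc (Matrix.vecCons i w) j :=
      fun i w j => Fin.cons_snoc_eq_snoc_cons i w j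
    simp only [h]

/-- `RM3_d` of a constant vector is that constant. -/
theorem recMaj3_const (b : Bool) : ∀ d, recMaj3 d (fun _ => b) = b
  | 0 => rfl
  | d + 1 => by rw [recMaj3, recMaj3_const b d]; cases b <;> rfl

/-- Little-endian numbering of the leaves: appending a last letter `j` adds `j·3^d`. -/
theorem ffe_snoc_val (d : ℕ) (w : Fin d → Fin 3) (j : Fin 3) :
    ((finFunctionFinEquiv (Fin.snoc w j) : Fin (3 ^ (d + 1))) : ℕ) =
      (finFunctionFinEquiv w : ℕ) + (j : ℕ) * 3 ^ d := by
  rw [finFunctionFinEquiv_apply, finFunctionFinEquiv_apply, Fin.sum_univ_castSucc]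
  simp only [Fin.snoc_castSucc, Fin.val_castSucc, Fin.snoc_last, Fin.val_last]

/-! ### The verifier's rounds evaluate `RM3_d` -/

/-- One round on `[c 0, …, c (3^{d+1} − 1)]` is `[MAJ3(c t, c (t + 3^d), c (t + 2·3^d))]_{t < 3^d}`. -/
theorem round_map_range (c : ℕ → Bool) (d : ℕ) :
    round ((List.range (3 ^ (d + 1))).map c) =
      (List.range (3 ^ d)).map fun t => maj3 (c t) (c (t + 3 ^ d)) (c (t + 2 * 3 ^ d)) := by
  have hlen : ((List.range (3 ^ (d + 1))).map c).length = 3 ^ (d + 1) := by simp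
  have hdiv : 3 ^ (d + 1) / 3 = 3 ^ d := by rw [pow_succ, Nat.mul_div_cancel _ (by norm_num)]
  have hmin : min (3 ^ (d + 1) / 3) (3 ^ (d + 1)) = 3 ^ d := by
    rw [hdiv]; exact min_eq_left (Nat.pow_le_pow_right (by norm_num) (Nat.le_succ d))
  -- entries of `map c (range m)` (cf. `HardcoreSharpP.getD_map_range`, not imported here)
  have hget : ∀ {m t : ℕ}, t < m → ((List.range m).map c).getD t false = c t := fun {m t} ht => by
    rw [List.getD_eq_getElem?_getD, List.getElem?_map, List.getElem?_range ht]; rfl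
  rw [SlicesNP.round, hlen, hmin, hdiv]
  refine List.map_congr_left fun t ht => ?_
  rw [List.mem_range] at ht
  have h3 : 3 ^ (d + 1) = 3 * 3 ^ d := by rw [pow_succ, mul_comm]
  rw [hget (by omega), hget (by omega), hget (by omega)]
  rfl

/-- **The `d` rounds evaluate `RM3_d`** on the block bits numbered little-endian. -/
theorem rounds_eval : ∀ (d : ℕ) (c : ℕ → Bool),
    rounds d ((List.range (3 ^ d)).map c) = [recMaj3 d fun w => c (finFunctionFinEquiv w)]
  | 0, c => by
    simp only [SlicesNP.rounds, List.replicate_zero, List.foldl_nil, pow_zero, List.range_one,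
      List.map_singleton, recMaj3]
    congr 1
  | d + 1, c => by
    have h : rounds (d + 1) ((List.range (3 ^ (d + 1))).map c) =
        rounds d (round ((List.range (3 ^ (d + 1))).map c)) := by
      simp only [SlicesNP.rounds, List.replicate_succ, List.foldl_cons]
    rw [h, round_map_range, rounds_eval d, recMaj3_succ_snoc]
    congr 1
    congr 1
    funext w
    rw [ffe_snoc_val, ffe_snoc_val, ffe_snoc_val]
    simp

/-! ### Parameters -/

/-- `ampLen` is injective on `k < n`: the length determines `(n, k)`. -/
theorem ampLen_inj {n k n' k' : ℕ} (hk : k < n) (hk' : k' < n') (h : ampLen n k = ampLen n' k') :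
    n = n' ∧ k = k' := by
  have hmono : ∀ {a b : ℕ}, a ≤ b → ampLen a 0 ≤ ampLen b 0 := fun {a b} hab => by
    unfold ampLen
    exact Nat.add_le_add_right (Nat.mul_le_mul (Nat.pow_le_pow_right (by norm_num)
      (Nat.log_mono_right hab)) (Nat.mul_le_mul hab hab)) 0
  have hk0 : ∀ a j : ℕ, ampLen a 0 ≤ ampLen a j := fun a j => by unfold ampLen; omega
  rcases lt_trichotomy n n' with hlt | rfl | hlt
  · exfalso
    have h1 := ampLen_lt_ampLen_succ n k k' (by omega)
    have h2 : ampLen (n + 1) k' ≤ ampLen n' k' := by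
      have := hmono (show n + 1 ≤ n' by omega)
      unfold ampLen at this ⊢; omega
    omega
  · refine ⟨rfl, ?_⟩
    unfold ampLen at h; omega
  · exfalso
    have h1 := ampLen_lt_ampLen_succ n' k' k (by omega)
    have h2 : ampLen (n' + 1) k ≤ ampLen n k := by
      have := hmono (show n' + 1 ≤ n by omega)
      unfold ampLen at this ⊢; omega
    omega

/-- The checks pin down the parameters: `(cn y, ck y, cd y) = (n, k, ⌊log₃ n⌋)`. -/
theorem params_of_checks {n k : ℕ} (hkn : k < n) {u y : List Bool} (hu : u.length = ampLen n k)
    (hc : checks u y = true) : cn y = n ∧ ck y = k ∧ cd y = Nat.log 3 n := by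
  obtain ⟨-, hk', h3, h3', hlen⟩ := checks_eq_true_iff.1 hc
  have hd : cd y = Nat.log 3 (cn y) := (Nat.log_eq_of_pow_le_of_lt_pow h3 h3').symm
  have hlen' : ampLen (cn y) (ck y) = ampLen n k := by rw [← hu, hlen, ampLen, hd]
  obtain ⟨hn, hk⟩ := ampLen_inj hk' hkn hlen'
  exact ⟨hn, hk, by rw [hd, hn]⟩

/-! ### The slice at `ampLen n k` -/

variable {n k : ℕ}

/-- Block `w`'s `n × n` bit matrix inside an input of length `ampLen n k`. -/
theorem blockPos_lt (w : Fin (Nat.log 3 n) → Fin 3) (t : Fin (n * n)) :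
    (finFunctionFinEquiv w : ℕ) * (n * n) + t < ampLen n k := by
  have hw := (finFunctionFinEquiv w).2
  unfold ampLen
  have : ((finFunctionFinEquiv w : ℕ) + 1) * (n * n) ≤ 3 ^ Nat.log 3 n * (n * n) :=
    Nat.mul_le_mul_right _ hw
  have ht := t.2
  nlinarith

/-- The `w`-th block of `x` as an `n × n` bit matrix. -/
def blockVec (x : Fin (ampLen n k) → Bool) (w : Fin (Nat.log 3 n) → Fin 3) : Fin (n * n) → Bool :=
  fun t => x ⟨(finFunctionFinEquiv w : ℕ) * (n * n) + t, blockPos_lt w t⟩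

/-- The slice function in closed form: `RM3_d` of the block clique indicators. -/
noncomputable def ampSlice (n k : ℕ) (x : Fin (ampLen n k) → Bool) : Bool :=
  recMaj3 (Nat.log 3 n) fun w => cliqueFn n k (edgeVec (blockVec x w))

/-- `ampSlice` is monotone. -/
theorem ampSlice_monotone (n k : ℕ) : Monotone (ampSlice n k) := by
  intro x x' hxx'
  refine recMaj3_monotone _ fun w => cliqueFn_monotone_holds n k fun e => ?_
  exact hxx' _

/-- Reading position `w' n² + (b + n a)` of `ofFn x` reads the block matrix. -/
theorem getD_ofFn_block (x : Fin (ampLen n k) → Bool) (w : Fin (Nat.log 3 n) → Fin 3)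
    {t : ℕ} (ht : t < n * n) :
    (List.ofFn x).getD ((finFunctionFinEquiv w : ℕ) * (n * n) + t) false = blockVec x w ⟨t, ht⟩ := by
  rw [Kannan.getD_ofFn x (blockPos_lt w ⟨t, ht⟩)]
  rfl

/-- Soundness of a block bit: an accepted block has a `k`-clique. -/
theorem clique_of_blockBit (x : Fin (ampLen n k) → Bool) (T : List Bool)
    (w : Fin (Nat.log 3 n) → Fin 3)
    (h : blockBit (List.ofFn x) T n k (finFunctionFinEquiv w) = true) :
    cliqueFn n k (edgeVec (blockVec x w)) = true := by
  classical
  obtain ⟨hcnt, hpairs⟩ := blockBit_eq_true_iff.1 h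
  rw [cliqueFn_edgeVec_iff]
  refine ⟨univ.filter fun v : Fin n => T.getD ((finFunctionFinEquiv w : ℕ) * n + v) false = true, ?_, ?_⟩
  · rw [card_filter_univ_fin n fun v => T.getD ((finFunctionFinEquiv w : ℕ) * n + v) false = true,
      ← markCount_eq_card, hcnt]
  · intro a ha b hb hab hlt
    simp only [mem_filter, mem_univ, true_and] at ha hb
    have h1 := hpairs a b a.2 b.2 hab ha hb
    rwa [getD_ofFn_block x w hlt] at h1

/-- The slice is non-constant: all-zero input. -/
theorem ampSlice_false (hk : 3 ≤ k) : ampSlice n k (fun _ => false) = false := by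
  unfold ampSlice
  have h : ∀ w : Fin (Nat.log 3 n) → Fin 3, cliqueFn n k (edgeVec (blockVec (k := k) (fun _ => false) w)) = false := by
    intro w
    rw [Bool.eq_false_iff, Ne, cliqueFn_edgeVec_iff]
    rintro ⟨S, hcard, hS⟩
    have h2 : 1 < S.card := by omega
    obtain ⟨a, ha, b, hb, hab⟩ := Finset.one_lt_card.1 h2
    rcases lt_or_gt_of_ne hab with hlt | hlt
    · have := hS a ha b hb hlt (by have := a.2; have := b.2; nlinarith)
      simp [blockVec] at this
    · have := hS b hb a ha hlt (by have := a.2; have := b.2; nlinarith)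
      simp [blockVec] at this
  simp only [h]
  exact recMaj3_const false _

/-- The slice is non-constant: all-one input (`k ≤ n`). -/
theorem ampSlice_true (hkn : k ≤ n) : ampSlice n k (fun _ => true) = true := by
  classical
  unfold ampSlice
  have h : ∀ w : Fin (Nat.log 3 n) → Fin 3, cliqueFn n k (edgeVec (blockVec (k := k) (fun _ => true) w)) = true := by
    intro w
    rw [cliqueFn_edgeVec_iff]
    obtain ⟨S, hS⟩ := (Finset.powersetCard_nonempty (s := (univ : Finset (Fin n))) (n := k)).2
      (by rw [card_univ, Fintype.card_fin]; exact hkn)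
    exact ⟨S, (mem_powersetCard.1 hS).2, fun a _ b _ _ _ => rfl⟩
  simp only [h]
  exact recMaj3_const true _

end Summit.PneNP.PneNP.Theorems.NegLimitedAmplifiedWindow
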